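import Summits.QuantumFields.YangMills.Theorems.UnitScaleTiltProp8ChartBridge
import Summits.QuantumFields.YangMills.Theorems.UnitScaleTiltProp8IterPlaqSmallAllL
import HarnessLib

/-!
# Route `UnitScaleTilt`, crux K1 «MinimiserStabilityRegPr» (stmt-QuantumFields-19200), registered stub V2′ `stub_halvingStep` — pillar P3 (chart), the PINNING
# of the chart to the family's descent for EVERY BLOCK SIZE: **the unguarded iterate IS the k-fold (0.4)-descent on (6)(ε₀), `L ∈ {3, 5}` INCLUDED**

Cell `ym3-torus` (HUMAN RULING D-0037, YM ladder rung R3 — continuum SU(2) YM₃ on the torus is a RUNG, not the Clay problem), width seat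
`ym-ust-19200-w3` gen 0.  `--supports stmt-QuantumFields-19200 --as helper`; def-free, 0 sorry, standard axioms.

WHY.  ★ym-ust-19200-p2 g5's `Prop8Chart.small_iter_T3` / `coe_emlIterU_unitsField_T3` (p537184) — «on (6)(ε₀) the unguarded complexified iterate `emlIterU`
IS the family's k-fold descent, so `chartLog`/`chartQ` are PINNED to the stub's `InB`» (the junction between the P3 chart text `Prop8Chart.ChartRemainderAt`
and the constraint (156) of [Balaban1985Variational]) — carry `7 ≤ F.L`, inherited from `IterPlaqSmall.plaqSmall_iter_T3_lt`.  The item is EVERY odd `L > 1`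
(V8-VET-CHECKLIST item 9).  With ym3-torus-p1 g18's all-`L` plaquette smallness `IterPlaqSmallAllL.plaqSmall_iter_T3_allL` (p577141) the same two
statements hold WITHOUT the block-size threshold, under the single smallness `10⁷·L³·ε₀ ≤ 1`:
* `plaqSmall_iter_uniform_T3_allL` — every iterated average `Ū^{(i)}`, `i ≤ K − n`, is `(10800L + 1)ε₀`-small (uniform level-free size).
* `small_iter_T3_allL` — the (0.4) guard `Small expMeanLogSU` at every level `i < K − n` (`(5L)²/4·(10800L+1)ε₀ ≤ 1/50 < δ_{SU(2)}`).
* `coe_emlIterU_unitsField_T3_allL` — the pinning, every `L` (p2 g5's `coe_emlIterU_unitsField` by name).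

HONEST SCOPE: bookkeeping over landed theorems; constants not optimised.  No definition, no sorry, standard axioms.  NOT a claim about the crux,
the rung, or the mass gap.

References: T. Bałaban, CMP **102** (1985) 277–309 [Balaban1985Variational] ((146) p.301, (156) p.302); CMP **109** (1987) 249–301 [Balaban1987RG1] ((0.4) p.253).
-/

set_option autoImplicit false

noncomputable section

open scoped BigOperators Matrix.Norms.L2Operator

namespace Summit.QuantumFields.YangMills.Theorems.Prop8ChartAllL

open Literature.MathematicalPhysics.QuantumFieldTheory.Balaban1983to89
open T4Continuum BlockAveraging ExpMeanLog LatticeWordStokes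
open B10Eq27TorusAxialLog (unitsField toUField)
open T3ContinuumYM3Torus T3RegularMinimiser T3PrintedMinimiserExistence
open Summit.QuantumFields.YangMills.Theorems.IterPlaqSmall (one_div_fifty_lt_deltaSU_fin_two)
open Summit.QuantumFields.YangMills.Theorems.IterPlaqSmallAllL (plaqSmall_iter_T3_allL)
open Summit.QuantumFields.YangMills.Theorems.Prop8Chart (emlIterU coe_emlIterU_unitsField)

/-- **UNIFORM MULTI-LEVEL PLAQUETTE SMALLNESS ON (6)(ε₀), EVERY BLOCK SIZE**: for `0 < ε₀`, `10⁷L³ε₀ ≤ 1` and `U` with plaquettes within `ε₀L^{−2(K−n)}` of `1`,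
every iterated average `Ū^{(i)}`, `i ≤ K − n`, has plaquettes within `(10800L + 1)ε₀` of `1` (p1 g18's level-`i` size `(10800L+1)·L^{2i}·ε₀L^{−2(K−n)}` is at most
this). [cite: Balaban1985Variational, (146) p.301] -/
theorem plaqSmall_iter_uniform_T3_allL (F : T3Family) (n K : ℕ) {ε₀ : ℝ} (hε₀ : 0 < ε₀) (hε : 10 ^ 7 * (F.L : ℝ) ^ 3 * ε₀ ≤ 1)
    (U : GaugeField (F.P K) 0 (Matrix.specialUnitaryGroup (Fin 2) ℂ)) (hU : PlaqSmall (regThreshold F n K ε₀) U) :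
    ∀ i, i ≤ K - n → PlaqSmall ((10800 * (F.L : ℝ) + 1) * ε₀)
      (Averaging.iter (fun j => blockAvg (P := F.P K) (j := j) (expMeanLogSU (n := Fin 2))) i U) := by
  intro i hik
  have hL1 : (1 : ℝ) ≤ F.L := by exact_mod_cast (le_of_lt F.hL.2)
  have h := plaqSmall_iter_T3_allL F n K hε₀ hε U hU i hik
  refine plaqSmall_of_le ?_ h
  refine mul_le_mul_of_nonneg_left ?_ (by positivity)
  show (F.L : ℝ) ^ (2 * i) * (ε₀ * ((F.L : ℝ)⁻¹) ^ (2 * (K - n))) ≤ ε₀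
  have hpow : (F.L : ℝ) ^ (2 * i) * ((F.L : ℝ)⁻¹) ^ (2 * (K - n)) ≤ 1 := by
    rw [inv_pow, ← div_eq_mul_inv, div_le_one (by positivity)]
    exact pow_le_pow_right₀ hL1 (by omega)
  calc (F.L : ℝ) ^ (2 * i) * (ε₀ * ((F.L : ℝ)⁻¹) ^ (2 * (K - n)))
      = ε₀ * ((F.L : ℝ) ^ (2 * i) * ((F.L : ℝ)⁻¹) ^ (2 * (K - n))) := by ring
    _ ≤ ε₀ * 1 := mul_le_mul_of_nonneg_left hpow hε₀.le
    _ = ε₀ := mul_one _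

/-- **THE (0.4) GUARD HOLDS AT EVERY LEVEL ON (6)(ε₀), EVERY BLOCK SIZE** (`0 < ε₀`, `10⁷L³ε₀ ≤ 1`): the loop variables of every iterated average `Ū^{(i)}`,
`i < K − n`, are `δ_{SU(2)}`-small (`LatticeWordStokes.small_of_plaqSmall`: `(5L)²/4·(10800L + 1)ε₀ ≤ 1/50 < δ_{SU(2)}`).
[cite: Balaban1985Variational, (146) p.301; Balaban1987RG1, (0.4) p.253] -/
theorem small_iter_T3_allL (F : T3Family) (n K : ℕ) {ε₀ : ℝ} (hε₀ : 0 < ε₀) (hε : 10 ^ 7 * (F.L : ℝ) ^ 3 * ε₀ ≤ 1)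
    (U : GaugeField (F.P K) 0 (Matrix.specialUnitaryGroup (Fin 2) ℂ)) (hU : PlaqSmall (regThreshold F n K ε₀) U) :
    ∀ i, i < K - n → ∀ c : PBond (F.P K) (i + 1),
      Small (expMeanLogSU (n := Fin 2)) (Averaging.iter (fun j => blockAvg (P := F.P K) (j := j) (expMeanLogSU (n := Fin 2))) i U) c := by
  intro i hik c
  have hL1 : (1 : ℝ) ≤ F.L := by exact_mod_cast (le_of_lt F.hL.2)
  have hL0 : (0 : ℝ) < F.L := by linarith
  have hplaq := plaqSmall_iter_uniform_T3_allL F n K hε₀ hε U hU i hik.le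
  have ht0 : (0 : ℝ) ≤ (10800 * (F.L : ℝ) + 1) * ε₀ := by positivity
  refine small_of_plaqSmall (expMeanLogSU (n := Fin 2)) ht0 hplaq ?_ c
  -- `(5L)²/4 · (10800L+1)ε₀ ≤ 1/50 < δ₂`
  have hd : (F.P K).d = 3 := T3Family.P_d F K
  have hLL : ((F.P K).L : ℝ) = F.L := rfl
  rw [expMeanLogSU_δ, hd]
  push_cast
  rw [hLL, Fintype.card_fin]
  have hδ := one_div_fifty_lt_deltaSU_fin_two
  rw [deltaSU, Fintype.card_fin] at hδ
  refine lt_of_le_of_lt ?_ hδ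
  -- `(25/4)·L²·(10800L + 1)·ε₀ ≤ (25/4)·10801·L³·ε₀ ≤ 10⁷L³ε₀/50 ≤ 1/50`
  have h3 : (F.L : ℝ) ^ 2 * (10800 * (F.L : ℝ) + 1) ≤ 10801 * (F.L : ℝ) ^ 3 := by nlinarith [pow_pos hL0 2]
  have h5 : (5 * (F.L : ℝ)) ^ 2 / 4 * ((10800 * (F.L : ℝ) + 1) * ε₀) =
      25 / 4 * ((F.L : ℝ) ^ 2 * (10800 * (F.L : ℝ) + 1) * ε₀) := by ring
  have h6 : (F.L : ℝ) ^ 2 * (10800 * (F.L : ℝ) + 1) * ε₀ ≤ 10801 * ((F.L : ℝ) ^ 3 * ε₀) := by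
    have := mul_le_mul_of_nonneg_right h3 hε₀.le
    linarith [this]
  have h7 : (F.L : ℝ) ^ 3 * ε₀ ≤ 1 / 10 ^ 7 := by
    rw [le_div_iff₀ (by norm_num)]
    linarith [hε]
  rw [h5]
  nlinarith [h6, h7]

/-- **PINNING AT THE d = 3 CARRIER, EVERY BLOCK SIZE**: for a configuration of (6)(ε₀) (`0 < ε₀`, `10⁷L³ε₀ ≤ 1`), for every `i ≤ K − n` and every level-`i`
bond the unguarded iterate `emlIterU i` of the field read in `M₂(ℂ)ˣ` IS the family's `i`-fold (0.4)-descent as matrices (p2 g5's `coe_emlIterU_unitsField` with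
the all-`L` guard). [cite: Balaban1985Variational, (156) p.302; Balaban1987RG1, (0.11) p.253] -/
theorem coe_emlIterU_unitsField_T3_allL (F : T3Family) (n K : ℕ) {ε₀ : ℝ} (hε₀ : 0 < ε₀) (hε : 10 ^ 7 * (F.L : ℝ) ^ 3 * ε₀ ≤ 1)
    (U : GaugeField (F.P K) 0 (Matrix.specialUnitaryGroup (Fin 2) ℂ)) (hU : PlaqSmall (regThreshold F n K ε₀) U) :
    ∀ i, i ≤ K - n → ∀ b : PBond (F.P K) i,
      ((emlIterU i (unitsField (toUField U)) b : (Matrix (Fin 2) (Fin 2) ℂ)ˣ) : Matrix (Fin 2) (Fin 2) ℂ) =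
        ((Averaging.iter (fun j => blockAvg (P := F.P K) (j := j) (expMeanLogSU (n := Fin 2))) i U b : Matrix.specialUnitaryGroup (Fin 2) ℂ) :
          Matrix (Fin 2) (Fin 2) ℂ) :=
  coe_emlIterU_unitsField U (K - n) (small_iter_T3_allL F n K hε₀ hε U hU)

end Summit.QuantumFields.YangMills.Theorems.Prop8ChartAllL

end
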